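import Literature.NumberTheory.Automorphic.TotallyRealModularityBoxImagesProofs
import Literature.NumberTheory.Automorphic.TotallyRealModularitySmallImage
import HarnessLib

/-!
# Box 2022, Theorem 1.1 deduced from Theorem 1.3 and Theorem 1.5 (proofs only)

Topic `Literature/NumberTheory/Automorphic`; a PROOFS file (theorems only: no definition, no
named fact; D-0014 / D-0026), sibling of `TotallyRealModularity.lean` (named fact
`Box2022_theorem1_1`), `TotallyRealModularityBoxImages.lean` (named fact `Box2022_theorem1_3`),
`TotallyRealModularityBoxImagesProofs.lean` (Thm. 1.3 from four printed lifting theorems) and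
`TotallyRealModularitySmallImage.lean` (named fact `Box2022_theorem1_5_modular`).

## What the source prints (held text `paper:arxiv-2103.13975`, pp. 3–5)

J. Box, *Elliptic curves over totally real quartic fields not containing `√5` are modular*, Trans.
Amer. Math. Soc. 375 (2022) [Box2022], §1: **Theorem 1.1** "Let `E` be an elliptic curve over a
totally real quartic number field not containing a square root of `5`. Then `E` is modular."
§1.2, proof of Thm. 1.1 (p. 5, verbatim up to notation): by Thm. 1.3, a non-modular `E` over a
totally real quartic `K` with `√5 ∉ K` — for which `K ∩ ℚ(ζ₇) = ℚ` is automatic, `ζ₇ + ζ₇⁻¹`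
being cubic — has `Im ρ̄_{E,3} ⊆ B(3)` or `C_s⁺(3)`, `Im ρ̄_{E,5} ⊆ B(5)` and `Im ρ̄_{E,7} ⊆ B(7)`
or `G(e7)` up to conjugacy (Thm. 1.2: "`E` gives rise to a `K`-point on one of the curves
`X(b3,b5,b7)`, `X(s3,b5,b7)`, `X(b3,b5,e7)`, `X(s3,b5,e7)`"); by Thm. 1.5 with Thm. 1.4 (Ribet)
and the small-`j` paragraph every such curve is modular — contradiction.

## What is proved

* `Box2022_theorem1_1_of_theorem1_3_of_theorem1_5` — `Box2022_theorem1_3 → Box2022_theorem1_5_modular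
  → Box2022_theorem1_1`: the printed deduction, kernel-checked (classical, by contradiction; the
  hypothesis of Thm. 1.3 (iii) is `Box2022.cubic7_ne_zero`, `3 ∤ 4`).
* `Box2022_theorem1_1_of_liftingTheorems` — `Box2022_theorem1_1` from the FOUR PRINTED LIFTING
  THEOREMS behind Thm. 1.3 (`FLS2015_theorem3`, `FLS2015_theorem4`, `Kalyanswamy2018_theorem1_2`,
  and (T) = Thorne 2016, Thm. 7.5 for `ρ_{E,p}`, written out exactly as the binder `hT` of
  `Box2022_theorem1_3_of_fourLiftingTheorems`; FLS Prop. 9.1 (c) being the tree theorem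
  `FLS2015_prop9_1c_holds`) plus `Box2022_theorem1_5_modular`.  Consequently the discharge of the
  named fact `Box2022_theorem1_1` is EXACTLY the discharge of those five printed theorems (four
  `R = T` theorems and Box's determination of the quartic points, §§3–6); every field-theoretic,
  group-theoretic and logical step in between is checked by the kernel.

HONEST STATUS: both theorems are CONDITIONAL (named-fact hypotheses); this file discharges nothing
and proves modularity of no curve.  Deliberately NOT here: any new definition; the Summits-side
consumption (route `Langlands/SqrtFiveQuarticCovers`, crux `BoxQuartic`), which lives under
`Summits/Langlands/Langlands/Theorems/`.

## References

* [Box2022] J. Box, Trans. Amer. Math. Soc. 375 (2022), doi:10.1090/tran/8557 =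
  arXiv:2103.13975: Thm. 1.1 (p. 3), §1.2 with Thms. 1.2–1.5 (pp. 4–5).
* [FreitasLeHungSiksek2015] Invent. Math. 201 (2015), Thms. 3–4, Prop. 9.1; [Kalyanswamy2018]
  Math. Res. Lett. 25 (2018), Thm. 1.2; [Thorne2016] Math. Ann. 364 (2016), Thms. 7.5–7.6;
  [Ribet2004QCurves] Progr. Math. 224 (2004) (Thm. 1.4).
-/

open scoped NumberField MatrixGroups
open NumberField Field Matrix Literature.NumberTheory.GaloisRepresentations

noncomputable section

namespace Literature.NumberTheory.Automorphic

/-- **Box 2022, Thm. 1.1 from Thm. 1.3 and Thm. 1.5 (with Thm. 1.4)** — the printed deduction of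
§1.2, kernel-checked: for `K` totally real quartic with `√5 ∉ K` (`¬ IsSquare (5 : K)`) and
`E / 𝓞 K` with `Δ ≠ 0`, if `E` were not automorphic of weight zero then Thm. 1.3 (named fact
`Box2022_theorem1_3`; (ii) uses `√5 ∉ K`, (iii) uses `K ∩ ℚ(ζ₇) = ℚ`, automatic for `[K:ℚ] = 4`
by `Box2022.cubic7_ne_zero`) puts its mod-`3`, `5`, `7` images in the `b5`-locus
`{B(3), C_s⁺(3)} × {B(5)} × {B(7), G(e7)}`, and Thm. 1.5/1.4 (named fact
`Box2022_theorem1_5_modular`) makes every such curve automorphic — contradiction.  CONDITIONAL on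
the two named facts (taken as hypotheses). [cite: Box2022, Thm. 1.1 and its proof (§1.2, Thms. 1.2–1.5)] -/
theorem Box2022_theorem1_1_of_theorem1_3_of_theorem1_5 (h13 : Box2022_theorem1_3)
    (h15 : Box2022_theorem1_5_modular) : Box2022_theorem1_1 := by
  intro K _ _ _ hd h5 E hE
  by_contra hne
  obtain ⟨h3, h5c, h7⟩ := h13 K E hE hne
  have h3' : ¬ 3 ∣ Module.finrank ℚ K := by rw [hd]; decide
  exact hne (h15 K hd E hE h3 (h5c h5) (h7 fun x => Box2022.cubic7_ne_zero h3' x))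

/-- **Box 2022, Thm. 1.1 from the four printed lifting theorems and Thm. 1.5.**  Inputs:
`FLS2015_theorem3` (FLS 2015, Thm. 3: `p = 3`, and `p = 5` inside Thorne's Thm. 7.6),
`FLS2015_theorem4` (ibid., Thm. 4: `p = 7`), `Kalyanswamy2018_theorem1_2` (Kalyanswamy 2018,
Thm. 1.2), hypothesis (T) = Thorne 2016, Thm. 7.5 (= Thm. 1.2) for `ρ_{E,p}` written out (verbatim
the binder `hT` of `Box2022_theorem1_3_of_fourLiftingTheorems` and
`Thorne2016_theorem7_6_of_dihedralLifting`), and `Box2022_theorem1_5_modular` (Box 2022, Thm. 1.5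
with Thm. 1.4).  Proof: `Box2022_theorem1_3_of_fourLiftingTheorems` (FLS Prop. 9.1 (c) is the tree
theorem `FLS2015_prop9_1c_holds`) then `Box2022_theorem1_1_of_theorem1_3_of_theorem1_5`.
CONDITIONAL on the five printed theorems (taken as hypotheses); with it, the named fact
`Box2022_theorem1_1` is a derived statement of the tree modulo exactly these.
[cite: Box2022, Thm. 1.1, proof of Thm. 1.3, Thm. 1.5] [cite: FreitasLeHungSiksek2015, Thms. 3–4]
[cite: Kalyanswamy2018, Thm. 1.2] [cite: Thorne2016, Thms. 7.5–7.6] -/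
theorem Box2022_theorem1_1_of_liftingTheorems (h3 : FLS2015_theorem3) (h4 : FLS2015_theorem4)
    (hKal : Kalyanswamy2018_theorem1_2)
    (hT : ∀ (F : Type) [Field F] [NumberField F] [IsTotallyReal F] (p : ℕ) [Fact p.Prime], p ≠ 2 →
      ∀ (E : WeierstrassCurve (𝓞 F)), E.Δ ≠ 0 →
        ∀ ρ : ModPGaloisRep F (ZMod p) 2, (E.baseChange F).IsTorsionGaloisRep p ρ →
          FramedRep.IsAbsolutelyIrreducible ρ →
          ∀ (L : Type) [Field L] [Algebra F L] [IsCyclotomicExtension {p} F L],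
            (∃ (k : Type) (_ : Field k) (f : ZMod p →+* k) (Q : GL (Fin 2) k),
                (∀ τ : absoluteGaloisGroup L,
                  Q * Matrix.GeneralLinearGroup.map f (FramedGaloisRep.restrictField L ρ τ) * Q⁻¹ ∈
                    Serre1972.diagonalSubgroup k) ∧
                ∃ τ : absoluteGaloisGroup L,
                  ((Q * Matrix.GeneralLinearGroup.map f (FramedGaloisRep.restrictField L ρ τ) *
                      Q⁻¹ : GL (Fin 2) k) : Matrix (Fin 2) (Fin 2) k) 0 0 ≠
                    ((Q * Matrix.GeneralLinearGroup.map f (FramedGaloisRep.restrictField L ρ τ) *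
                      Q⁻¹ : GL (Fin 2) k) : Matrix (Fin 2) (Fin 2) k) 1 1) →
            (∃ (M : Type) (_ : Field M) (_ : Algebra F M),
                Module.finrank F M = 2 ∧ IsTotallyReal M ∧ Nonempty (M →ₐ[F] L)) →
            IsAutomorphicOfWeightZero E)
    (h15 : Box2022_theorem1_5_modular) : Box2022_theorem1_1 :=
  Box2022_theorem1_1_of_theorem1_3_of_theorem1_5
    (Box2022_theorem1_3_of_fourLiftingTheorems h3 h4 hKal hT) h15

end Literature.NumberTheory.Automorphic

end
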